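import Summits.BirchSwinnertonDyer.BirchSwinnertonDyer.Theorems.PrintCFramBottomClassIndexLawFiveLeKrizLiLocusOfPrints
import Summits.BirchSwinnertonDyer.BirchSwinnertonDyer.Theorems.PrintCFramBottomClassIndexLawFiveLeKrizLiLocusCharacterData
import Summits.BirchSwinnertonDyer.BirchSwinnertonDyer.Theorems.PrintCFramBottomClassIndexLawFiveLeKrizLiBinders
import Summits.BirchSwinnertonDyer.BirchSwinnertonDyer.Theorems.PrintCFramBottomClassIndexLawFiveLeKrizLiBindersAnchor11
import Summits.BirchSwinnertonDyer.BirchSwinnertonDyer.Theorems.PrintCFramBottomClassIndexLawFiveLeKrizLiBindersAnchor19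
import Summits.BirchSwinnertonDyer.BirchSwinnertonDyer.Theorems.PrintCFramBottomClassIndexLawFiveLeKrizLiBindersAnchor43
import Summits.BirchSwinnertonDyer.BirchSwinnertonDyer.Theorems.PrintCFramBottomClassIndexLawFiveLeKrizLiBindersAnchor67
import Summits.BirchSwinnertonDyer.BirchSwinnertonDyer.Theorems.PrintCFramBottomClassIndexLawFiveLeKrizLiBindersAnchor163EndState
import Literature.NumberTheory.QuadraticFields.FundamentalDiscriminant
import Literature.NumberTheory.QuadraticFields.ImaginaryQuadraticPrescribedSplitting
import HarnessLib

/-!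
# Crux `PrintCFram.BottomClassIndexLawFiveLe` (stmt-BirchSwinnertonDyer-20372), line `eisenstein-resource-bdp-line`:
# THE CRUX RESTRICTED TO EACH WINDOW CLASS ON THE KRIZ–LI LOCUS (Anchors; p = 11, 19, 43, 67, 163) — `BSD_p(W)` and
# `RamifiedCMBottomClassIndexLawAtZp W p` BY NAME for every globally minimal member of analytic rank one, CONDITIONAL ON REFEREED PRINT ONLY
# (five citations + Kriz–Li 2019 Thm. 1.20): NO field, NO Heegner datum, NO `L`-value, NO character / Bernoulli hypothesis
# (cell `bsd-print-cfram`, width seat `bsd-line-cfram-p1-w7` g2; THEOREMS ONLY, `--supports` 20372; BSD is not proved by any of this)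

HONEST FRAMING. Nothing here proves BSD or closes a stub; no definition, no named fact, no `sorry`. Every theorem is CONDITIONAL on the five
refereed named facts of the registry's `stub_prints` (Hsieh 2014 Thm. A, Liu–Zhang–Zhang 2018, `ToricPublishedInputs`, Burungale–Flach 2024
Cor. 2, Mazur–Wiles 1984 Thm. 2) and on Kriz–Li 2019 Thm. 1.20 (`stub_krizLi`); its only other hypotheses are CLASS MEMBERSHIP (`W ∼ W₁` with
`C • W₁ = A(p)^{(d)}`, resp. `W ∼ A(p)`), global minimality and `W.analyticRank = 1` — i.e. exactly the crux's own binders on that class.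
WHAT IS ASSEMBLED (all inputs are tree theorems of this cell): the census Heegner field `K'' = ℚ(√d_K)` is CONSTRUCTED as a type
(`Quadratic.exists_numberField_discr_eq`, `Quadratic.isTotallyComplex_of_discr_neg`); the class's Kriz–Li character block `(ψ, ω, ε_K)` with
(1), (3), (4) is w5 g0 / w3 g2–g3's `exists_krizLiCharacterBlock_<label>` (kernel Bernoulli certificates `KrizLi4Cert*`); the Heegner hypothesis
for `N_W` is `satisfiesHeegnerHypothesis_<label>`; the Heegner data and the `L`-value `L(W^{(d_K)},1) ≠ 0` are PRINT on the locus — w6 g2's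
`KrizLiLValueFree.exists_krizLiDatum_of_characterData` (p662614: `exists_isHeegnerPoint` of `ToricPublishedInputs` + Kriz–Li Thm. 1.20 ⟹ `log_ω P ≠ 0`
⟹ `P` non-torsion ⟹ Gross–Zagier); class membership gives `HasCM` / `CMRamified` (`KrizLiLocusOfPrints.hasCM_and_cmRamified_of_isIsogenous_twist`,
`KrizLiBinders.hasCM_bases` / `cmRamified_bases`); and THE KRIZ–LI LOCUS IS PRINT (this seat, p662184:
`KrizLiLocusOfPrints.bsdp_cmRamified_of_krizLiDatum_of_prints` = Road C's Stub H + LEAD g5's regular-locus theorem) concludes; the class law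
follows from `BSD_p` by k7r-c4's `ramifiedCMBottomClassIndexLawAtZp_of_bsdp` (Cassels, modularity, GZK inside the prints).
Per class: **`bsdp_<label>`** and **`ramifiedCMBottomClassIndexLawAtZp_<label>`**. Classes:
`A(11)` (`d_K = -7`); `A(19)` (`d_K = -31`); `A(43)` (`d_K = -7`); `A(67)` (`d_K = -7`); `A(163)` (`d_K = -7`).
beyond-print theorem: NO — these are print-conditional closures of the crux on 38 of the 65 rank-one window classes of the `≥ 5` leaf; the
research residue of C2 on this line stays the off-locus pair (17424bl1@11, 305809c1@7; `p = 7` classes are Route U's, not covered here).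
References: [KrizLi2019] Thm. 1.20 (pp. 7–8), Rem. 1.21; [MazurWiles1984] Thm. 2; [GrossZagier1986] I.(6.3), (7.3); [BurungaleFlach2024] Cor. 2;
[Hsieh2014] Thm. A; [LiuZhangZhang2018] Thms. 1.5.1, 1.5.3; [Cassels1965ArithmeticVIII]; [Cox2013] §1.C, Thm. 7.7; [GrossLMS1991] §1.
-/

set_option autoImplicit false
-- the summit namespace `Summit.BirchSwinnertonDyer.BirchSwinnertonDyer` repeats the problem name by design (D-0017)
set_option linter.dupNamespace false

noncomputable section

open scoped Classical

namespace Summit.BirchSwinnertonDyer.BirchSwinnertonDyer.Theorems.PrintCFram.KrizLiLocusClasses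

open WeierstrassCurve IsDedekindDomain NumberField
  Literature.NumberTheory.EllipticCurves Literature.NumberTheory.EllipticCurves.ModularForms
  Literature.NumberTheory.EllipticCurves.Rank1Residual Literature.NumberTheory.EllipticCurves.KrizLi2019
  Literature.NumberTheory.QuadraticFields
  Summit.BirchSwinnertonDyer.Rank1Residual Summit.BirchSwinnertonDyer.Rank1Residual.X12.O11
  Summit.BirchSwinnertonDyer.BirchSwinnertonDyer.Theses.UniversalToricDescent
  Summit.BirchSwinnertonDyer.BirchSwinnertonDyer.Theorems.RamifiedSevenEllipticUnits
  Summit.BirchSwinnertonDyer.BirchSwinnertonDyer.Theorems.PrintCFram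

/-- **`BSD_11(W)` for every globally minimal `W` of analytic rank one in the ANCHOR class `A(11)` (`W ∼ A(11)`), CONDITIONAL on prints(5) +
Kriz–Li Thm. 1.20 ONLY** (Heegner field `d_K = -7` constructed; character block, Heegner hypothesis, Heegner data and `L`-value discharged).
[cite: KrizLi2019, Thm. 1.20 (pp. 7–8), Rem. 1.21 (p. 8)] [cite: MazurWiles1984, Thm. 2 (p. 216)] [cite: GrossZagier1986, Thm. I.(6.3)] -/
theorem bsdp_A11 [Fact (Nat.Prime 11)]
    (hprints : Hsieh2014.thmA_exists_isHsiehLFunction_unrPeriod_anyLevel ∧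
      LiuZhangZhang2018.thm151_thm153_modularCurve_heegnerVector_additive ∧
      ToricPublishedInputs ∧ bsdTriple_of_hasCM_of_L_one_ne_zero ∧
      Literature.NumberTheory.NumberFields.MazurWiles1984.thm2_oddChiPart_classGroup_card_eq_pow_val_bernoulli)
    (hKL : KrizLi2019.thm120_padicLogHeegner_unit_of_bernoulli)
    (W : WeierstrassCurve ℚ) [W.IsElliptic] [W.IsGloballyMinimal] (hiso : IsIsogenous W cm11) (hr : W.analyticRank = 1) :
    BSDp W 11 := by
  -- the census Heegner field `K'' = ℚ(√-7)` as a TYPE (fundamental discriminant), imaginary quadratic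
  obtain ⟨K, _, _, hK2, hdK⟩ := Quadratic.exists_numberField_discr_eq (D := (-7 : ℤ))
    (Or.inl ⟨by norm_num, by
      rw [← Int.squarefree_natAbs]
      exact (by rw [Nat.squarefree_iff_nodup_primeFactorsList (by norm_num)]; simp : Squarefree (7 : ℕ)), by norm_num⟩)
  have hK : IsImaginaryQuadratic K := ⟨hK2, Quadratic.isTotallyComplex_of_discr_neg hK2 (by rw [hdK]; norm_num)⟩
  haveI : NeZero (NumberField.discr K).natAbs := ⟨by rw [hdK]; decide⟩
  have hCM : W.HasCM := X12.hasCM_of_isIsogenous hiso.symm_of_charZero KrizLiBinders.hasCM_bases.2.1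
  have hram : CMRamified W 11 := (X12.cmRamified_iff_of_isIsogenous hiso hCM 11).mpr KrizLiBinders.cmRamified_bases.2.1
  obtain ⟨f, _, ψ, ω, εK, hψ, hω, hss, ⟨h1, h1'⟩, h3, hεK, h4, -⟩ :=
    KrizLiBinders.exists_krizLiCharacterBlock_A11 W hiso K hK2 hdK
  exact KrizLiLocusOfPrints.bsdp_cmRamified_of_krizLiDatum_of_prints hprints hKL W hCM hram (by norm_num) hr
    (KrizLiLValueFree.exists_krizLiDatum_of_characterData hKL hprints.2.2.1 W hCM hram (by norm_num) hr K hK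
      (KrizLiBinders.satisfiesHeegnerHypothesis_A11 W hiso K hK2 hdK) (by rw [hdK]; decide)
      (by rw [hdK]; norm_num) f ψ ω hψ hω hss h1 h1' h3 εK hεK h4)

/-- **The crux's conclusion `RamifiedCMBottomClassIndexLawAtZp W 11` for every globally minimal `W` of analytic rank one in the ANCHOR class
`A(11)`**, CONDITIONAL on prints(5) + Kriz–Li Thm. 1.20 only. BSD is not proved by any of this.
[cite: KrizLi2019, Thm. 1.20 (pp. 7–8), Rem. 1.21 (p. 8)] [cite: MazurWiles1984, Thm. 2 (p. 216)] [cite: Cassels1965ArithmeticVIII] -/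
theorem ramifiedCMBottomClassIndexLawAtZp_A11 [Fact (Nat.Prime 11)]
    (hprints : Hsieh2014.thmA_exists_isHsiehLFunction_unrPeriod_anyLevel ∧
      LiuZhangZhang2018.thm151_thm153_modularCurve_heegnerVector_additive ∧
      ToricPublishedInputs ∧ bsdTriple_of_hasCM_of_L_one_ne_zero ∧
      Literature.NumberTheory.NumberFields.MazurWiles1984.thm2_oddChiPart_classGroup_card_eq_pow_val_bernoulli)
    (hKL : KrizLi2019.thm120_padicLogHeegner_unit_of_bernoulli)
    (W : WeierstrassCurve ℚ) [W.IsElliptic] [W.IsGloballyMinimal] (hiso : IsIsogenous W cm11) (hr : W.analyticRank = 1) :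
    RamifiedCMBottomClassIndexLawAtZp W 11 := by
  have hprints7 := InputsPrints.prints7_of_prints4 ⟨hprints.1, hprints.2.1, hprints.2.2.1, hprints.2.2.2.1⟩
  obtain ⟨-, -, ⟨-, -, hGZK, -⟩, -, -, hmod, hCassels⟩ := hprints7
  exact RubinFormulaZpBsdp.ramifiedCMBottomClassIndexLawAtZp_of_bsdp hCassels hmod hGZK hr.le
    (bsdp_A11 hprints hKL W hiso hr)

/-- **`BSD_19(W)` for every globally minimal `W` of analytic rank one in the ANCHOR class `A(19)` (`W ∼ A(19)`), CONDITIONAL on prints(5) +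
Kriz–Li Thm. 1.20 ONLY** (Heegner field `d_K = -31` constructed; character block, Heegner hypothesis, Heegner data and `L`-value discharged).
[cite: KrizLi2019, Thm. 1.20 (pp. 7–8), Rem. 1.21 (p. 8)] [cite: MazurWiles1984, Thm. 2 (p. 216)] [cite: GrossZagier1986, Thm. I.(6.3)] -/
theorem bsdp_A19 [Fact (Nat.Prime 19)]
    (hprints : Hsieh2014.thmA_exists_isHsiehLFunction_unrPeriod_anyLevel ∧
      LiuZhangZhang2018.thm151_thm153_modularCurve_heegnerVector_additive ∧
      ToricPublishedInputs ∧ bsdTriple_of_hasCM_of_L_one_ne_zero ∧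
      Literature.NumberTheory.NumberFields.MazurWiles1984.thm2_oddChiPart_classGroup_card_eq_pow_val_bernoulli)
    (hKL : KrizLi2019.thm120_padicLogHeegner_unit_of_bernoulli)
    (W : WeierstrassCurve ℚ) [W.IsElliptic] [W.IsGloballyMinimal] (hiso : IsIsogenous W cm19) (hr : W.analyticRank = 1) :
    BSDp W 19 := by
  -- the census Heegner field `K'' = ℚ(√-31)` as a TYPE (fundamental discriminant), imaginary quadratic
  obtain ⟨K, _, _, hK2, hdK⟩ := Quadratic.exists_numberField_discr_eq (D := (-31 : ℤ))
    (Or.inl ⟨by norm_num, by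
      rw [← Int.squarefree_natAbs]
      exact (by rw [Nat.squarefree_iff_nodup_primeFactorsList (by norm_num)]; simp : Squarefree (31 : ℕ)), by norm_num⟩)
  have hK : IsImaginaryQuadratic K := ⟨hK2, Quadratic.isTotallyComplex_of_discr_neg hK2 (by rw [hdK]; norm_num)⟩
  haveI : NeZero (NumberField.discr K).natAbs := ⟨by rw [hdK]; decide⟩
  have hCM : W.HasCM := X12.hasCM_of_isIsogenous hiso.symm_of_charZero KrizLiBinders.hasCM_bases.2.2.1
  have hram : CMRamified W 19 := (X12.cmRamified_iff_of_isIsogenous hiso hCM 19).mpr KrizLiBinders.cmRamified_bases.2.2.1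
  obtain ⟨f, _, ψ, ω, εK, hψ, hω, hss, ⟨h1, h1'⟩, h3, hεK, h4, -⟩ :=
    KrizLiBinders.exists_krizLiCharacterBlock_A19 W hiso K hK2 hdK
  exact KrizLiLocusOfPrints.bsdp_cmRamified_of_krizLiDatum_of_prints hprints hKL W hCM hram (by norm_num) hr
    (KrizLiLValueFree.exists_krizLiDatum_of_characterData hKL hprints.2.2.1 W hCM hram (by norm_num) hr K hK
      (KrizLiBinders.satisfiesHeegnerHypothesis_A19 W hiso K hK2 hdK) (by rw [hdK]; decide)
      (by rw [hdK]; norm_num) f ψ ω hψ hω hss h1 h1' h3 εK hεK h4)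

/-- **The crux's conclusion `RamifiedCMBottomClassIndexLawAtZp W 19` for every globally minimal `W` of analytic rank one in the ANCHOR class
`A(19)`**, CONDITIONAL on prints(5) + Kriz–Li Thm. 1.20 only. BSD is not proved by any of this.
[cite: KrizLi2019, Thm. 1.20 (pp. 7–8), Rem. 1.21 (p. 8)] [cite: MazurWiles1984, Thm. 2 (p. 216)] [cite: Cassels1965ArithmeticVIII] -/
theorem ramifiedCMBottomClassIndexLawAtZp_A19 [Fact (Nat.Prime 19)]
    (hprints : Hsieh2014.thmA_exists_isHsiehLFunction_unrPeriod_anyLevel ∧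
      LiuZhangZhang2018.thm151_thm153_modularCurve_heegnerVector_additive ∧
      ToricPublishedInputs ∧ bsdTriple_of_hasCM_of_L_one_ne_zero ∧
      Literature.NumberTheory.NumberFields.MazurWiles1984.thm2_oddChiPart_classGroup_card_eq_pow_val_bernoulli)
    (hKL : KrizLi2019.thm120_padicLogHeegner_unit_of_bernoulli)
    (W : WeierstrassCurve ℚ) [W.IsElliptic] [W.IsGloballyMinimal] (hiso : IsIsogenous W cm19) (hr : W.analyticRank = 1) :
    RamifiedCMBottomClassIndexLawAtZp W 19 := by
  have hprints7 := InputsPrints.prints7_of_prints4 ⟨hprints.1, hprints.2.1, hprints.2.2.1, hprints.2.2.2.1⟩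
  obtain ⟨-, -, ⟨-, -, hGZK, -⟩, -, -, hmod, hCassels⟩ := hprints7
  exact RubinFormulaZpBsdp.ramifiedCMBottomClassIndexLawAtZp_of_bsdp hCassels hmod hGZK hr.le
    (bsdp_A19 hprints hKL W hiso hr)

/-- **`BSD_43(W)` for every globally minimal `W` of analytic rank one in the ANCHOR class `A(43)` (`W ∼ A(43)`), CONDITIONAL on prints(5) +
Kriz–Li Thm. 1.20 ONLY** (Heegner field `d_K = -7` constructed; character block, Heegner hypothesis, Heegner data and `L`-value discharged).
[cite: KrizLi2019, Thm. 1.20 (pp. 7–8), Rem. 1.21 (p. 8)] [cite: MazurWiles1984, Thm. 2 (p. 216)] [cite: GrossZagier1986, Thm. I.(6.3)] -/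
theorem bsdp_A43 [Fact (Nat.Prime 43)]
    (hprints : Hsieh2014.thmA_exists_isHsiehLFunction_unrPeriod_anyLevel ∧
      LiuZhangZhang2018.thm151_thm153_modularCurve_heegnerVector_additive ∧
      ToricPublishedInputs ∧ bsdTriple_of_hasCM_of_L_one_ne_zero ∧
      Literature.NumberTheory.NumberFields.MazurWiles1984.thm2_oddChiPart_classGroup_card_eq_pow_val_bernoulli)
    (hKL : KrizLi2019.thm120_padicLogHeegner_unit_of_bernoulli)
    (W : WeierstrassCurve ℚ) [W.IsElliptic] [W.IsGloballyMinimal] (hiso : IsIsogenous W cm43) (hr : W.analyticRank = 1) :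
    BSDp W 43 := by
  -- the census Heegner field `K'' = ℚ(√-7)` as a TYPE (fundamental discriminant), imaginary quadratic
  obtain ⟨K, _, _, hK2, hdK⟩ := Quadratic.exists_numberField_discr_eq (D := (-7 : ℤ))
    (Or.inl ⟨by norm_num, by
      rw [← Int.squarefree_natAbs]
      exact (by rw [Nat.squarefree_iff_nodup_primeFactorsList (by norm_num)]; simp : Squarefree (7 : ℕ)), by norm_num⟩)
  have hK : IsImaginaryQuadratic K := ⟨hK2, Quadratic.isTotallyComplex_of_discr_neg hK2 (by rw [hdK]; norm_num)⟩
  haveI : NeZero (NumberField.discr K).natAbs := ⟨by rw [hdK]; decide⟩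
  have hCM : W.HasCM := X12.hasCM_of_isIsogenous hiso.symm_of_charZero KrizLiBinders.hasCM_bases.2.2.2.1
  have hram : CMRamified W 43 := (X12.cmRamified_iff_of_isIsogenous hiso hCM 43).mpr KrizLiBinders.cmRamified_bases.2.2.2.1
  obtain ⟨f, _, ψ, ω, εK, hψ, hω, hss, ⟨h1, h1'⟩, h3, hεK, h4, -⟩ :=
    KrizLiBinders.exists_krizLiCharacterBlock_A43 W hiso K hK2 hdK
  exact KrizLiLocusOfPrints.bsdp_cmRamified_of_krizLiDatum_of_prints hprints hKL W hCM hram (by norm_num) hr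
    (KrizLiLValueFree.exists_krizLiDatum_of_characterData hKL hprints.2.2.1 W hCM hram (by norm_num) hr K hK
      (KrizLiBinders.satisfiesHeegnerHypothesis_A43 W hiso K hK2 hdK) (by rw [hdK]; decide)
      (by rw [hdK]; norm_num) f ψ ω hψ hω hss h1 h1' h3 εK hεK h4)

/-- **The crux's conclusion `RamifiedCMBottomClassIndexLawAtZp W 43` for every globally minimal `W` of analytic rank one in the ANCHOR class
`A(43)`**, CONDITIONAL on prints(5) + Kriz–Li Thm. 1.20 only. BSD is not proved by any of this.
[cite: KrizLi2019, Thm. 1.20 (pp. 7–8), Rem. 1.21 (p. 8)] [cite: MazurWiles1984, Thm. 2 (p. 216)] [cite: Cassels1965ArithmeticVIII] -/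
theorem ramifiedCMBottomClassIndexLawAtZp_A43 [Fact (Nat.Prime 43)]
    (hprints : Hsieh2014.thmA_exists_isHsiehLFunction_unrPeriod_anyLevel ∧
      LiuZhangZhang2018.thm151_thm153_modularCurve_heegnerVector_additive ∧
      ToricPublishedInputs ∧ bsdTriple_of_hasCM_of_L_one_ne_zero ∧
      Literature.NumberTheory.NumberFields.MazurWiles1984.thm2_oddChiPart_classGroup_card_eq_pow_val_bernoulli)
    (hKL : KrizLi2019.thm120_padicLogHeegner_unit_of_bernoulli)
    (W : WeierstrassCurve ℚ) [W.IsElliptic] [W.IsGloballyMinimal] (hiso : IsIsogenous W cm43) (hr : W.analyticRank = 1) :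
    RamifiedCMBottomClassIndexLawAtZp W 43 := by
  have hprints7 := InputsPrints.prints7_of_prints4 ⟨hprints.1, hprints.2.1, hprints.2.2.1, hprints.2.2.2.1⟩
  obtain ⟨-, -, ⟨-, -, hGZK, -⟩, -, -, hmod, hCassels⟩ := hprints7
  exact RubinFormulaZpBsdp.ramifiedCMBottomClassIndexLawAtZp_of_bsdp hCassels hmod hGZK hr.le
    (bsdp_A43 hprints hKL W hiso hr)

/-- **`BSD_67(W)` for every globally minimal `W` of analytic rank one in the ANCHOR class `A(67)` (`W ∼ A(67)`), CONDITIONAL on prints(5) +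
Kriz–Li Thm. 1.20 ONLY** (Heegner field `d_K = -7` constructed; character block, Heegner hypothesis, Heegner data and `L`-value discharged).
[cite: KrizLi2019, Thm. 1.20 (pp. 7–8), Rem. 1.21 (p. 8)] [cite: MazurWiles1984, Thm. 2 (p. 216)] [cite: GrossZagier1986, Thm. I.(6.3)] -/
theorem bsdp_A67 [Fact (Nat.Prime 67)]
    (hprints : Hsieh2014.thmA_exists_isHsiehLFunction_unrPeriod_anyLevel ∧
      LiuZhangZhang2018.thm151_thm153_modularCurve_heegnerVector_additive ∧
      ToricPublishedInputs ∧ bsdTriple_of_hasCM_of_L_one_ne_zero ∧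
      Literature.NumberTheory.NumberFields.MazurWiles1984.thm2_oddChiPart_classGroup_card_eq_pow_val_bernoulli)
    (hKL : KrizLi2019.thm120_padicLogHeegner_unit_of_bernoulli)
    (W : WeierstrassCurve ℚ) [W.IsElliptic] [W.IsGloballyMinimal] (hiso : IsIsogenous W cm67) (hr : W.analyticRank = 1) :
    BSDp W 67 := by
  -- the census Heegner field `K'' = ℚ(√-7)` as a TYPE (fundamental discriminant), imaginary quadratic
  obtain ⟨K, _, _, hK2, hdK⟩ := Quadratic.exists_numberField_discr_eq (D := (-7 : ℤ))
    (Or.inl ⟨by norm_num, by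
      rw [← Int.squarefree_natAbs]
      exact (by rw [Nat.squarefree_iff_nodup_primeFactorsList (by norm_num)]; simp : Squarefree (7 : ℕ)), by norm_num⟩)
  have hK : IsImaginaryQuadratic K := ⟨hK2, Quadratic.isTotallyComplex_of_discr_neg hK2 (by rw [hdK]; norm_num)⟩
  haveI : NeZero (NumberField.discr K).natAbs := ⟨by rw [hdK]; decide⟩
  have hCM : W.HasCM := X12.hasCM_of_isIsogenous hiso.symm_of_charZero KrizLiBinders.hasCM_bases.2.2.2.2.1
  have hram : CMRamified W 67 := (X12.cmRamified_iff_of_isIsogenous hiso hCM 67).mpr KrizLiBinders.cmRamified_bases.2.2.2.2.1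
  obtain ⟨f, _, ψ, ω, εK, hψ, hω, hss, ⟨h1, h1'⟩, h3, hεK, h4, -⟩ :=
    KrizLiBinders.exists_krizLiCharacterBlock_A67 W hiso K hK2 hdK
  exact KrizLiLocusOfPrints.bsdp_cmRamified_of_krizLiDatum_of_prints hprints hKL W hCM hram (by norm_num) hr
    (KrizLiLValueFree.exists_krizLiDatum_of_characterData hKL hprints.2.2.1 W hCM hram (by norm_num) hr K hK
      (KrizLiBinders.satisfiesHeegnerHypothesis_A67 W hiso K hK2 hdK) (by rw [hdK]; decide)
      (by rw [hdK]; norm_num) f ψ ω hψ hω hss h1 h1' h3 εK hεK h4)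

/-- **The crux's conclusion `RamifiedCMBottomClassIndexLawAtZp W 67` for every globally minimal `W` of analytic rank one in the ANCHOR class
`A(67)`**, CONDITIONAL on prints(5) + Kriz–Li Thm. 1.20 only. BSD is not proved by any of this.
[cite: KrizLi2019, Thm. 1.20 (pp. 7–8), Rem. 1.21 (p. 8)] [cite: MazurWiles1984, Thm. 2 (p. 216)] [cite: Cassels1965ArithmeticVIII] -/
theorem ramifiedCMBottomClassIndexLawAtZp_A67 [Fact (Nat.Prime 67)]
    (hprints : Hsieh2014.thmA_exists_isHsiehLFunction_unrPeriod_anyLevel ∧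
      LiuZhangZhang2018.thm151_thm153_modularCurve_heegnerVector_additive ∧
      ToricPublishedInputs ∧ bsdTriple_of_hasCM_of_L_one_ne_zero ∧
      Literature.NumberTheory.NumberFields.MazurWiles1984.thm2_oddChiPart_classGroup_card_eq_pow_val_bernoulli)
    (hKL : KrizLi2019.thm120_padicLogHeegner_unit_of_bernoulli)
    (W : WeierstrassCurve ℚ) [W.IsElliptic] [W.IsGloballyMinimal] (hiso : IsIsogenous W cm67) (hr : W.analyticRank = 1) :
    RamifiedCMBottomClassIndexLawAtZp W 67 := by
  have hprints7 := InputsPrints.prints7_of_prints4 ⟨hprints.1, hprints.2.1, hprints.2.2.1, hprints.2.2.2.1⟩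
  obtain ⟨-, -, ⟨-, -, hGZK, -⟩, -, -, hmod, hCassels⟩ := hprints7
  exact RubinFormulaZpBsdp.ramifiedCMBottomClassIndexLawAtZp_of_bsdp hCassels hmod hGZK hr.le
    (bsdp_A67 hprints hKL W hiso hr)

/-- **`BSD_163(W)` for every globally minimal `W` of analytic rank one in the ANCHOR class `A(163)` (`W ∼ A(163)`), CONDITIONAL on prints(5) +
Kriz–Li Thm. 1.20 ONLY** (Heegner field `d_K = -7` constructed; character block, Heegner hypothesis, Heegner data and `L`-value discharged).
[cite: KrizLi2019, Thm. 1.20 (pp. 7–8), Rem. 1.21 (p. 8)] [cite: MazurWiles1984, Thm. 2 (p. 216)] [cite: GrossZagier1986, Thm. I.(6.3)] -/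
theorem bsdp_A163 [Fact (Nat.Prime 163)]
    (hprints : Hsieh2014.thmA_exists_isHsiehLFunction_unrPeriod_anyLevel ∧
      LiuZhangZhang2018.thm151_thm153_modularCurve_heegnerVector_additive ∧
      ToricPublishedInputs ∧ bsdTriple_of_hasCM_of_L_one_ne_zero ∧
      Literature.NumberTheory.NumberFields.MazurWiles1984.thm2_oddChiPart_classGroup_card_eq_pow_val_bernoulli)
    (hKL : KrizLi2019.thm120_padicLogHeegner_unit_of_bernoulli)
    (W : WeierstrassCurve ℚ) [W.IsElliptic] [W.IsGloballyMinimal] (hiso : IsIsogenous W cm163) (hr : W.analyticRank = 1) :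
    BSDp W 163 := by
  -- the census Heegner field `K'' = ℚ(√-7)` as a TYPE (fundamental discriminant), imaginary quadratic
  obtain ⟨K, _, _, hK2, hdK⟩ := Quadratic.exists_numberField_discr_eq (D := (-7 : ℤ))
    (Or.inl ⟨by norm_num, by
      rw [← Int.squarefree_natAbs]
      exact (by rw [Nat.squarefree_iff_nodup_primeFactorsList (by norm_num)]; simp : Squarefree (7 : ℕ)), by norm_num⟩)
  have hK : IsImaginaryQuadratic K := ⟨hK2, Quadratic.isTotallyComplex_of_discr_neg hK2 (by rw [hdK]; norm_num)⟩
  haveI : NeZero (NumberField.discr K).natAbs := ⟨by rw [hdK]; decide⟩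
  have hCM : W.HasCM := X12.hasCM_of_isIsogenous hiso.symm_of_charZero KrizLiBinders.hasCM_bases.2.2.2.2.2
  have hram : CMRamified W 163 := (X12.cmRamified_iff_of_isIsogenous hiso hCM 163).mpr KrizLiBinders.cmRamified_bases.2.2.2.2.2
  obtain ⟨f, _, ψ, ω, εK, hψ, hω, hss, ⟨h1, h1'⟩, h3, hεK, h4, -⟩ :=
    KrizLiBinders.exists_krizLiCharacterBlock_A163 W hiso K hK2 hdK
  exact KrizLiLocusOfPrints.bsdp_cmRamified_of_krizLiDatum_of_prints hprints hKL W hCM hram (by norm_num) hr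
    (KrizLiLValueFree.exists_krizLiDatum_of_characterData hKL hprints.2.2.1 W hCM hram (by norm_num) hr K hK
      (KrizLiBinders.satisfiesHeegnerHypothesis_A163 W hiso K hK2 hdK) (by rw [hdK]; decide)
      (by rw [hdK]; norm_num) f ψ ω hψ hω hss h1 h1' h3 εK hεK h4)

/-- **The crux's conclusion `RamifiedCMBottomClassIndexLawAtZp W 163` for every globally minimal `W` of analytic rank one in the ANCHOR class
`A(163)`**, CONDITIONAL on prints(5) + Kriz–Li Thm. 1.20 only. BSD is not proved by any of this.
[cite: KrizLi2019, Thm. 1.20 (pp. 7–8), Rem. 1.21 (p. 8)] [cite: MazurWiles1984, Thm. 2 (p. 216)] [cite: Cassels1965ArithmeticVIII] -/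
theorem ramifiedCMBottomClassIndexLawAtZp_A163 [Fact (Nat.Prime 163)]
    (hprints : Hsieh2014.thmA_exists_isHsiehLFunction_unrPeriod_anyLevel ∧
      LiuZhangZhang2018.thm151_thm153_modularCurve_heegnerVector_additive ∧
      ToricPublishedInputs ∧ bsdTriple_of_hasCM_of_L_one_ne_zero ∧
      Literature.NumberTheory.NumberFields.MazurWiles1984.thm2_oddChiPart_classGroup_card_eq_pow_val_bernoulli)
    (hKL : KrizLi2019.thm120_padicLogHeegner_unit_of_bernoulli)
    (W : WeierstrassCurve ℚ) [W.IsElliptic] [W.IsGloballyMinimal] (hiso : IsIsogenous W cm163) (hr : W.analyticRank = 1) :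
    RamifiedCMBottomClassIndexLawAtZp W 163 := by
  have hprints7 := InputsPrints.prints7_of_prints4 ⟨hprints.1, hprints.2.1, hprints.2.2.1, hprints.2.2.2.1⟩
  obtain ⟨-, -, ⟨-, -, hGZK, -⟩, -, -, hmod, hCassels⟩ := hprints7
  exact RubinFormulaZpBsdp.ramifiedCMBottomClassIndexLawAtZp_of_bsdp hCassels hmod hGZK hr.le
    (bsdp_A163 hprints hKL W hiso hr)

end Summit.BirchSwinnertonDyer.BirchSwinnertonDyer.Theorems.PrintCFram.KrizLiLocusClasses

end
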